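import Literature.NumberTheory.Weil1964.LocalWeilIndexSpace
import Literature.LinearAlgebra.QuadraticForm.MaslovIndexTransverse
import Literature.LinearAlgebra.QuadraticForm.TransverseLagrangian
import Mathlib.Tactic.Module
import HarnessLib

/-!
# The Weil index of Kashiwara's form over a non-archimedean local field (Leray–Maslov–Weil index) and its
# chain condition

Topic `NumberTheory/Weil1964`; namespace `Literature.NumberTheory.Weil1964`. KERNEL mathematics only (one definition
with body + private plumbing + theorems; no named fact, no `axiom`, no `sorry`). The NON-ARCHIMEDEAN twin of the
tree's real Maslov index `Literature.LinearAlgebra.QuadraticForm.maslovIndex` ([LionVergne1980] §1.5, signature of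
Kashiwara's form over an ordered field): over a non-archimedean local field `F` of characteristic `≠ 2` there is no
signature, and the invariant that enters the metaplectic cocycle is the WEIL INDEX of the Leray invariant
([Rangarao1993] p. 336: "`c(σ₁, σ₂)` is the Weil index of the Leray invariant of the Lagrangian subspaces";
[MoeglinVignerasWaldspurger1987] Chap. 3 §I.3: "`c(g, g') = γ(ψ(q(g, g'))/2)`", `q(g, g')` the Leray invariant of
`(X, g⁻¹X, g'X)`; [Perrin1981]).

For `B` a bilinear form on a finite-dimensional `F`-space `V`, subspaces `ℓ₁, ℓ₂, ℓ₃`, a non-trivial continuous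
additive character `ψ` and a Haar measure `μ` we set

  `μ_ψ(ℓ₁, ℓ₂, ℓ₃) := γ(ψ ∘ Q_{ℓ₁,ℓ₂,ℓ₃})`  (`lerayWeilIndex ψ μ B ℓ₁ ℓ₂ ℓ₃ := weilIndexSpace ψ μ (kashiwaraForm B ℓ₁ ℓ₂ ℓ₃)`),

the Weil index (`LocalWeilIndexSpace`) of Kashiwara's quadratic form `Q(x₁ + x₂ + x₃) = B(x₁, x₂) + B(x₂, x₃) + B(x₃, x₁)`
on `ℓ₁ ⊕ ℓ₂ ⊕ ℓ₃` ([LionVergne1980] 1.5.1), and prove, following the printed REAL arguments of [LionVergne1980] §1.5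
with "signature" replaced by "Weil index" (both are additive on orthogonal sums, isometry invariants, change sign /
conjugate under `Q ↦ -Q`, and vanish / equal `1` on split forms):

* §1 `|μ| = 1`; **`Sp(B)`-invariance** `μ(gℓ₁, gℓ₂, gℓ₃) = μ(ℓ₁, ℓ₂, ℓ₃)` ([LionVergne1980] 1.5.2; [Rangarao1993] Thm 2.11);
  **dihedral symmetry** for `B` alternating: a transposition of two planes CONJUGATES `μ`, a cyclic permutation fixes
  it ([LionVergne1980] 1.5.3: `τ ↦ -τ`; `γ(-Q) = conj γ(Q)`).
* §2 **normalisation**: `μ(ℓ₁, ℓ₂, ℓ₃) = 1` as soon as `B(ℓ₁, ℓ₂) = 0` (then `Q` is split with respect to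
  `(ℓ₁ ⊕ ℓ₂) ⊕ ℓ₃`); in particular `μ = 1` when two of the three planes coincide and are isotropic ([Rangarao1993]
  §2.7 p. 348: "the Leray invariant is trivial when two of them coincide").
* §3 **the transverse case** ([LionVergne1980] 1.5.4 ↔ [Rangarao1993] Def. 2.4): for `B` alternating and `ℓ₁, ℓ₃`
  isotropic with `V = ℓ₁ ⊕ ℓ₃`, `μ(ℓ₁, ℓ₂, ℓ₃) = γ(ψ ∘ S)` for the quadratic form `S(x) = B(p₁₃ x, p₃₁ x)` on `ℓ₂`
  (the tree's `transverseForm`; Rao's `q(L₁, L₂, L₃)` is the isometry class of such a form on the middle plane):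
  `Q ≅ S ⊕ H` with `H(u, v) = B(u, v)` on `ℓ₁ × ℓ₃` SPLIT, so `γ(H) = 1`.
* §4 **the chain condition** ([LionVergne1980] 1.5.8; the cocycle identity behind [MoeglinVignerasWaldspurger1987]
  Chap. 3 §I.3 Théorème): for `B` alternating and non-degenerate (a symplectic space) and `ℓ₁, ℓ₂, ℓ₃, ℓ₄` Lagrangians
  (`ℓᵢ^⊥ = ℓᵢ`),  `μ(ℓ₁, ℓ₂, ℓ₃) = μ(ℓ₁, ℓ₂, ℓ₄) μ(ℓ₂, ℓ₃, ℓ₄) μ(ℓ₃, ℓ₁, ℓ₄)`.  Step (i) (a fourth plane transverse to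
  the three others) is the printed change of variables `xᵢ = yᵢ + p_{i4} y_{i+1}` under which
  `Q_{123} ≅ S_{314} ⊕ S_{124} ⊕ S_{234}` — it needs only `2` invertible (the tree's real file assumes `CharZero`);
  step (ii) uses a Lagrangian transverse to `ℓ₁, …, ℓ₄` (`exists_orthogonal_eq_self_isCompl_forall`, a local field
  being infinite) and the dihedral symmetry, `μ · conj μ = 1` replacing `τ - τ = 0`.

The algebraic identities of §3–§4 (`Q ∘ splitEquiv = S ⊕ H`, `Q ∘ chainEquiv = S ⊕ S ⊕ S`) are field-general and are
the ones proved privately inside `MaslovIndexTransverse.lean` / `MaslovIndexChain.lean` (there under `CharZero` for the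
second); they are re-derived here as private plumbing with `[Invertible (2 : F)]`, which is what a local field of odd
residue characteristic offers. -- TODO(dedupe): import them if those files publish the `Equivalent` statements.

## References

* [LionVergne1980] G. Lion, M. Vergne, *The Weil representation, Maslov index and Theta series*, PM 6, Birkhäuser
  (1980), Part I §1.5.1–1.5.4, 1.5.8.
* [Rangarao1993] R. Ranga Rao, *On some explicit formulas in the theory of Weil representation*, Pacific J. Math. 157
  (1993) 335–371: p. 336, Def. 2.4 (p. 339), Def. 2.10 / Thm 2.11 (p. 344), Appendix Thm A.2–A.3 (pp. 366–367).
* [MoeglinVignerasWaldspurger1987] C. Mœglin, M.-F. Vignéras, J.-L. Waldspurger, *Correspondances de Howe sur un corps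
  p-adique*, LNM 1291 (1987), Chap. 3 §I.3 (invariant de Leray; Théorème [P], [Rao]).
* [Perrin1981] P. Perrin, *Représentations de Schrödinger, indice de Maslov et groupe metaplectique*, LNM 880 (1981)
  370–407.
-/

set_option autoImplicit false

noncomputable section

open MeasureTheory QuadraticMap Module
open Literature.LinearAlgebra.QuadraticForm
open scoped Classical

namespace Literature.NumberTheory.Weil1964

/-! ## §0 Field-general plumbing: the two changes of variables of [LionVergne1980] 1.5.4 and 1.5.8 -/

section Algebra

variable {K : Type*} [Field K]
variable {W : Type*} [AddCommGroup W] [Module K W]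

/-- the change of variables `(x₁, x₂, x₃) ↦ (x₂ ; x₁ - p₁₃ x₂, p₃₁ x₂ - x₃)` of `ℓ₁ × ℓ₂ × ℓ₃` with `ℓ₂ × (ℓ₁ × ℓ₃)`
(copy of the private plumbing of `MaslovIndexTransverse.lean`). [cite: LionVergne1980, §1.5.4 (proof)] -/
private def splitEquiv' (ℓ₁ ℓ₂ ℓ₃ : Submodule K W) (h : IsCompl ℓ₁ ℓ₃) :
    (ℓ₁ × ℓ₂ × ℓ₃) ≃ₗ[K] (ℓ₂ × (ℓ₁ × ℓ₃)) where
  toFun x := (x.2.1, (x.1 - ℓ₁.projectionOnto ℓ₃ h (x.2.1 : W), ℓ₃.projectionOnto ℓ₁ h.symm (x.2.1 : W) - x.2.2))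
  invFun y := (y.2.1 + ℓ₁.projectionOnto ℓ₃ h (y.1 : W), y.1, ℓ₃.projectionOnto ℓ₁ h.symm (y.1 : W) - y.2.2)
  map_add' x y := by
    refine Prod.ext rfl (Prod.ext ?_ ?_)
    · change (x + y).1 - ℓ₁.projectionOnto ℓ₃ h ((x + y).2.1 : W) =
        (x.1 - ℓ₁.projectionOnto ℓ₃ h (x.2.1 : W)) + (y.1 - ℓ₁.projectionOnto ℓ₃ h (y.2.1 : W))
      simp only [Prod.fst_add, Prod.snd_add, Submodule.coe_add, map_add]
      abel
    · change ℓ₃.projectionOnto ℓ₁ h.symm ((x + y).2.1 : W) - (x + y).2.2 =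
        (ℓ₃.projectionOnto ℓ₁ h.symm (x.2.1 : W) - x.2.2) + (ℓ₃.projectionOnto ℓ₁ h.symm (y.2.1 : W) - y.2.2)
      simp only [Prod.fst_add, Prod.snd_add, Submodule.coe_add, map_add]
      abel
  map_smul' c x := by
    refine Prod.ext rfl (Prod.ext ?_ ?_)
    · change (c • x).1 - ℓ₁.projectionOnto ℓ₃ h ((c • x).2.1 : W) =
        c • (x.1 - ℓ₁.projectionOnto ℓ₃ h (x.2.1 : W))
      simp only [Prod.smul_fst, Prod.smul_snd, Submodule.coe_smul, map_smul, smul_sub]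
    · change ℓ₃.projectionOnto ℓ₁ h.symm ((c • x).2.1 : W) - (c • x).2.2 =
        c • (ℓ₃.projectionOnto ℓ₁ h.symm (x.2.1 : W) - x.2.2)
      simp only [Prod.smul_fst, Prod.smul_snd, Submodule.coe_smul, map_smul, smul_sub]
  left_inv x := by ext <;> simp
  right_inv y := by ext <;> simp

/-- under `splitEquiv'`, Kashiwara's form splits as `S ⊕ H`, `S` the transverse form on `ℓ₂` and `H(u, v) = B(u, v)`
on `ℓ₁ × ℓ₃` (`B` alternating, `ℓ₁, ℓ₃` isotropic and complementary). [cite: LionVergne1980, §1.5.4 (proof)] -/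
private theorem prod_comp_splitEquiv' {B : LinearMap.BilinForm K W} (hB : LinearMap.IsAlt B)
    {ℓ₁ ℓ₂ ℓ₃ : Submodule K W} (h : IsCompl ℓ₁ ℓ₃) (h₁ : ∀ x ∈ ℓ₁, ∀ y ∈ ℓ₁, B x y = 0)
    (h₃ : ∀ x ∈ ℓ₃, ∀ y ∈ ℓ₃, B x y = 0) :
    ((transverseForm B ℓ₁ ℓ₂ ℓ₃ h).prod (pairingQF (B.compl₁₂ ℓ₁.subtype ℓ₃.subtype))).comp
        (splitEquiv' ℓ₁ ℓ₂ ℓ₃ h : (ℓ₁ × ℓ₂ × ℓ₃) →ₗ[K] (ℓ₂ × (ℓ₁ × ℓ₃))) =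
      kashiwaraForm B ℓ₁ ℓ₂ ℓ₃ := by
  ext x
  obtain ⟨x₁, x₂, x₃⟩ := x
  rw [QuadraticMap.comp_apply, QuadraticMap.prod_apply, kashiwaraForm_apply, transverseForm_apply,
    pairingQF_apply, LinearMap.compl₁₂_apply, Submodule.subtype_apply, Submodule.subtype_apply]
  change B (ℓ₁.projection ℓ₃ h x₂) (ℓ₃.projection ℓ₁ h.symm x₂) +
      B ((x₁ - ℓ₁.projectionOnto ℓ₃ h (x₂ : W) : ℓ₁) : W)
        ((ℓ₃.projectionOnto ℓ₁ h.symm (x₂ : W) - x₃ : ℓ₃) : W) =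
    B (x₁ : W) (x₂ : W) + B (x₂ : W) (x₃ : W) + B (x₃ : W) (x₁ : W)
  set a : W := ℓ₁.projection ℓ₃ h x₂ with ha
  set b : W := ℓ₃.projection ℓ₁ h.symm x₂ with hb
  have hx₂ : (x₂ : W) = a + b := (Submodule.projection_add_projection_eq_self h _).symm
  have ha₁ : a ∈ ℓ₁ := Submodule.projection_apply_mem h _
  have hb₃ : b ∈ ℓ₃ := Submodule.projection_apply_mem h.symm _
  have e₁ : ((x₁ - ℓ₁.projectionOnto ℓ₃ h (x₂ : W) : ℓ₁) : W) = (x₁ : W) - a := by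
    rw [Submodule.coe_sub, Submodule.coe_projectionOnto_apply]
  have e₃ : ((ℓ₃.projectionOnto ℓ₁ h.symm (x₂ : W) - x₃ : ℓ₃) : W) = b - (x₃ : W) := by
    rw [Submodule.coe_sub, Submodule.coe_projectionOnto_apply]
  rw [e₁, e₃, hx₂]
  have k₁ : B (x₁ : W) a = 0 := h₁ _ x₁.2 _ ha₁
  have k₃ : B b (x₃ : W) = 0 := h₃ _ hb₃ _ x₃.2
  have k : B (x₃ : W) (x₁ : W) = -B (x₁ : W) (x₃ : W) := (hB.neg _ _).symm
  simp only [map_add, map_sub, LinearMap.add_apply, LinearMap.sub_apply]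
  linear_combination -k₁ - k₃ - k

/-- `p_{i4} ∘ p_{j4} = p_{i4}` for two projections parallel to the same `ℓ₄`. [folklore] -/
private theorem projection_projection' {ℓᵢ ℓⱼ ℓ₄ : Submodule K W} (hᵢ : IsCompl ℓᵢ ℓ₄) (hⱼ : IsCompl ℓⱼ ℓ₄)
    (z : W) : ℓᵢ.projection ℓ₄ hᵢ (ℓⱼ.projection ℓ₄ hⱼ z) = ℓᵢ.projection ℓ₄ hᵢ z := by
  have h0 : ℓᵢ.projection ℓ₄ hᵢ (z - ℓⱼ.projection ℓ₄ hⱼ z) = 0 :=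
    (Submodule.projection_apply_eq_zero_iff hᵢ).2 (Submodule.sub_projection_mem hⱼ z)
  rw [map_sub, sub_eq_zero] at h0
  exact h0.symm

/-- the change of variables `(y₁, y₂, y₃) ↦ (y₁ + p₁₄ y₂, y₂ + p₂₄ y₃, y₃ + p₃₄ y₁)` of [LionVergne1980, 1.5.8] with
inverse `xᵢ ↦ ½ (xᵢ - p_{i4} x_{i+1} + p_{i4} x_{i+2})` — here with `⅟2` for a field with `2` invertible (copy of the
private plumbing of `MaslovIndexChain.lean`, there under `CharZero`). [cite: LionVergne1980, §1.5.8 (proof)] -/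
private def chainEquiv' [Invertible (2 : K)] (ℓ₁ ℓ₂ ℓ₃ ℓ₄ : Submodule K W) (h₁ : IsCompl ℓ₁ ℓ₄)
    (h₂ : IsCompl ℓ₂ ℓ₄) (h₃ : IsCompl ℓ₃ ℓ₄) : (ℓ₁ × ℓ₂ × ℓ₃) ≃ₗ[K] (ℓ₁ × ℓ₂ × ℓ₃) where
  toFun y := (y.1 + ℓ₁.projectionOnto ℓ₄ h₁ (y.2.1 : W), y.2.1 + ℓ₂.projectionOnto ℓ₄ h₂ (y.2.2 : W),
    y.2.2 + ℓ₃.projectionOnto ℓ₄ h₃ (y.1 : W))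
  invFun x := (⅟(2 : K) • (x.1 - ℓ₁.projectionOnto ℓ₄ h₁ (x.2.1 : W) + ℓ₁.projectionOnto ℓ₄ h₁ (x.2.2 : W)),
    ⅟(2 : K) • (x.2.1 - ℓ₂.projectionOnto ℓ₄ h₂ (x.2.2 : W) + ℓ₂.projectionOnto ℓ₄ h₂ (x.1 : W)),
    ⅟(2 : K) • (x.2.2 - ℓ₃.projectionOnto ℓ₄ h₃ (x.1 : W) + ℓ₃.projectionOnto ℓ₄ h₃ (x.2.1 : W)))
  map_add' x y := by
    refine Prod.ext ?_ (Prod.ext ?_ ?_)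
    · change (x + y).1 + ℓ₁.projectionOnto ℓ₄ h₁ ((x + y).2.1 : W) =
        (x.1 + ℓ₁.projectionOnto ℓ₄ h₁ (x.2.1 : W)) + (y.1 + ℓ₁.projectionOnto ℓ₄ h₁ (y.2.1 : W))
      simp only [Prod.fst_add, Prod.snd_add, Submodule.coe_add, map_add]
      abel
    · change (x + y).2.1 + ℓ₂.projectionOnto ℓ₄ h₂ ((x + y).2.2 : W) =
        (x.2.1 + ℓ₂.projectionOnto ℓ₄ h₂ (x.2.2 : W)) + (y.2.1 + ℓ₂.projectionOnto ℓ₄ h₂ (y.2.2 : W))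
      simp only [Prod.fst_add, Prod.snd_add, Submodule.coe_add, map_add]
      abel
    · change (x + y).2.2 + ℓ₃.projectionOnto ℓ₄ h₃ ((x + y).1 : W) =
        (x.2.2 + ℓ₃.projectionOnto ℓ₄ h₃ (x.1 : W)) + (y.2.2 + ℓ₃.projectionOnto ℓ₄ h₃ (y.1 : W))
      simp only [Prod.fst_add, Prod.snd_add, Submodule.coe_add, map_add]
      abel
  map_smul' c x := by
    refine Prod.ext ?_ (Prod.ext ?_ ?_)
    · change (c • x).1 + ℓ₁.projectionOnto ℓ₄ h₁ ((c • x).2.1 : W) =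
        c • (x.1 + ℓ₁.projectionOnto ℓ₄ h₁ (x.2.1 : W))
      simp only [Prod.smul_fst, Prod.smul_snd, Submodule.coe_smul, map_smul, smul_add]
    · change (c • x).2.1 + ℓ₂.projectionOnto ℓ₄ h₂ ((c • x).2.2 : W) =
        c • (x.2.1 + ℓ₂.projectionOnto ℓ₄ h₂ (x.2.2 : W))
      simp only [Prod.smul_fst, Prod.smul_snd, Submodule.coe_smul, map_smul, smul_add]
    · change (c • x).2.2 + ℓ₃.projectionOnto ℓ₄ h₃ ((c • x).1 : W) =
        c • (x.2.2 + ℓ₃.projectionOnto ℓ₄ h₃ (x.1 : W))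
      simp only [Prod.smul_fst, Prod.smul_snd, Submodule.coe_smul, map_smul, smul_add]
  left_inv y := by
    obtain ⟨y₁, y₂, y₃⟩ := y
    have h2 : ∀ v : W, ((2 : K) * ⅟(2 : K)) • v = v := fun v => by rw [mul_invOf_self, one_smul]
    have r₁ : ℓ₁.projection ℓ₄ h₁ (y₁ : W) = y₁ := Submodule.projection_apply_left h₁ y₁
    have r₂ : ℓ₂.projection ℓ₄ h₂ (y₂ : W) = y₂ := Submodule.projection_apply_left h₂ y₂
    have r₃ : ℓ₃.projection ℓ₄ h₃ (y₃ : W) = y₃ := Submodule.projection_apply_left h₃ y₃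
    have r₁₂ := projection_projection' h₁ h₂ (y₃ : W)
    have r₁₃ := projection_projection' h₁ h₃ (y₁ : W)
    have r₂₃ := projection_projection' h₂ h₃ (y₁ : W)
    have r₂₁ := projection_projection' h₂ h₁ (y₂ : W)
    have r₃₁ := projection_projection' h₃ h₁ (y₂ : W)
    have r₃₂ := projection_projection' h₃ h₂ (y₃ : W)
    refine Prod.ext ?_ (Prod.ext ?_ ?_) <;> apply Subtype.ext <;>
      simp only [Submodule.coe_add, Submodule.coe_sub, Submodule.coe_smul, Submodule.coe_projectionOnto_apply,
        map_add]
    · linear_combination (norm := module) (-⅟(2 : K)) • r₁₂ + ⅟(2 : K) • r₁₃ + ⅟(2 : K) • r₁ + h2 (y₁ : W)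
    · linear_combination (norm := module) (-⅟(2 : K)) • r₂₃ + ⅟(2 : K) • r₂₁ + ⅟(2 : K) • r₂ + h2 (y₂ : W)
    · linear_combination (norm := module) (-⅟(2 : K)) • r₃₁ + ⅟(2 : K) • r₃₂ + ⅟(2 : K) • r₃ + h2 (y₃ : W)
  right_inv x := by
    obtain ⟨x₁, x₂, x₃⟩ := x
    have h2 : ∀ v : W, ((2 : K) * ⅟(2 : K)) • v = v := fun v => by rw [mul_invOf_self, one_smul]
    have r₁ : ℓ₁.projection ℓ₄ h₁ (x₁ : W) = x₁ := Submodule.projection_apply_left h₁ x₁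
    have r₂ : ℓ₂.projection ℓ₄ h₂ (x₂ : W) = x₂ := Submodule.projection_apply_left h₂ x₂
    have r₃ : ℓ₃.projection ℓ₄ h₃ (x₃ : W) = x₃ := Submodule.projection_apply_left h₃ x₃
    have a₁ := projection_projection' h₁ h₂ (x₃ : W)
    have b₁ := projection_projection' h₁ h₂ (x₁ : W)
    have a₂ := projection_projection' h₂ h₃ (x₁ : W)
    have b₂ := projection_projection' h₂ h₃ (x₂ : W)
    have a₃ := projection_projection' h₃ h₁ (x₂ : W)
    have b₃ := projection_projection' h₃ h₁ (x₃ : W)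
    refine Prod.ext ?_ (Prod.ext ?_ ?_) <;> apply Subtype.ext <;>
      simp only [Submodule.coe_add, Submodule.coe_sub, Submodule.coe_smul, Submodule.coe_projectionOnto_apply,
        map_add, map_sub, map_smul]
    · linear_combination (norm := module) (-⅟(2 : K)) • a₁ + ⅟(2 : K) • b₁ + ⅟(2 : K) • r₁ + h2 (x₁ : W)
    · linear_combination (norm := module) (-⅟(2 : K)) • a₂ + ⅟(2 : K) • b₂ + ⅟(2 : K) • r₂ + h2 (x₂ : W)
    · linear_combination (norm := module) (-⅟(2 : K)) • a₃ + ⅟(2 : K) • b₃ + ⅟(2 : K) • r₃ + h2 (x₃ : W)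

/-- unfolding the forward map. [folklore] -/
private theorem chainEquiv'_apply [Invertible (2 : K)] (ℓ₁ ℓ₂ ℓ₃ ℓ₄ : Submodule K W) (h₁ : IsCompl ℓ₁ ℓ₄)
    (h₂ : IsCompl ℓ₂ ℓ₄) (h₃ : IsCompl ℓ₃ ℓ₄) (y : ℓ₁ × ℓ₂ × ℓ₃) :
    chainEquiv' ℓ₁ ℓ₂ ℓ₃ ℓ₄ h₁ h₂ h₃ y =
      (y.1 + ℓ₁.projectionOnto ℓ₄ h₁ (y.2.1 : W), y.2.1 + ℓ₂.projectionOnto ℓ₄ h₂ (y.2.2 : W),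
        y.2.2 + ℓ₃.projectionOnto ℓ₄ h₃ (y.1 : W)) := rfl

/-- "these transformations give the equivalence of `Q` and `Q'`": for `B` alternating, `ℓ₁, ℓ₂, ℓ₃, ℓ₄` isotropic and
`ℓ₄` complementary to `ℓ₁, ℓ₂, ℓ₃`, Kashiwara's form of `(ℓ₁, ℓ₂, ℓ₃)` pulled back along `chainEquiv'` is the orthogonal
sum of the transverse forms of `(ℓ₃, ℓ₁, ℓ₄)`, `(ℓ₁, ℓ₂, ℓ₄)`, `(ℓ₂, ℓ₃, ℓ₄)` (copy of the private plumbing of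
`MaslovIndexChain.lean`, valid for `2` invertible). [cite: LionVergne1980, §1.5.8 (proof)] -/
private theorem kashiwaraForm_comp_chainEquiv' [Invertible (2 : K)] {B : LinearMap.BilinForm K W}
    (hB : LinearMap.IsAlt B) {ℓ₁ ℓ₂ ℓ₃ ℓ₄ : Submodule K W} (h₁ : IsCompl ℓ₁ ℓ₄) (h₂ : IsCompl ℓ₂ ℓ₄)
    (h₃ : IsCompl ℓ₃ ℓ₄) (iso₁ : ∀ x ∈ ℓ₁, ∀ y ∈ ℓ₁, B x y = 0) (iso₂ : ∀ x ∈ ℓ₂, ∀ y ∈ ℓ₂, B x y = 0)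
    (iso₃ : ∀ x ∈ ℓ₃, ∀ y ∈ ℓ₃, B x y = 0) (iso₄ : ∀ x ∈ ℓ₄, ∀ y ∈ ℓ₄, B x y = 0) :
    (kashiwaraForm B ℓ₁ ℓ₂ ℓ₃).comp
        (chainEquiv' ℓ₁ ℓ₂ ℓ₃ ℓ₄ h₁ h₂ h₃ : (ℓ₁ × ℓ₂ × ℓ₃) →ₗ[K] (ℓ₁ × ℓ₂ × ℓ₃)) =
      (transverseForm B ℓ₃ ℓ₁ ℓ₄ h₃).prod
        ((transverseForm B ℓ₁ ℓ₂ ℓ₄ h₁).prod (transverseForm B ℓ₂ ℓ₃ ℓ₄ h₂)) := by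
  ext y
  obtain ⟨y₁, y₂, y₃⟩ := y
  rw [QuadraticMap.comp_apply, LinearEquiv.coe_coe, chainEquiv'_apply, kashiwaraForm_apply,
    QuadraticMap.prod_apply, QuadraticMap.prod_apply, transverseForm_apply, transverseForm_apply,
    transverseForm_apply, Submodule.projection_eq_self_sub_projection h₃,
    Submodule.projection_eq_self_sub_projection h₁, Submodule.projection_eq_self_sub_projection h₂]
  simp only [Submodule.coe_add, Submodule.coe_projectionOnto_apply]
  set a : W := ℓ₁.projection ℓ₄ h₁ (y₂ : W) with ha
  set b : W := ℓ₂.projection ℓ₄ h₂ (y₃ : W) with hb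
  set c : W := ℓ₃.projection ℓ₄ h₃ (y₁ : W) with hc
  have ma : a ∈ ℓ₁ := Submodule.projection_apply_mem h₁ _
  have mb : b ∈ ℓ₂ := Submodule.projection_apply_mem h₂ _
  have mc : c ∈ ℓ₃ := Submodule.projection_apply_mem h₃ _
  have qa : (y₂ : W) - a ∈ ℓ₄ := Submodule.sub_projection_mem h₁ _
  have qb : (y₃ : W) - b ∈ ℓ₄ := Submodule.sub_projection_mem h₂ _
  have qc : (y₁ : W) - c ∈ ℓ₄ := Submodule.sub_projection_mem h₃ _
  have s₁ : B c c = 0 := hB c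
  have s₂ : B a a = 0 := hB a
  have s₃ : B b b = 0 := hB b
  have f₁ : B a (y₁ : W) = 0 := iso₁ _ ma _ y₁.2
  have e₁ : B ((y₂ : W) - a) ((y₁ : W) - c) = 0 := iso₄ _ qa _ qc
  have g₁ : B c a = -B a c := (hB.neg a c).symm
  have k₁ : B (y₁ : W) (y₂ : W) = -B (y₂ : W) (y₁ : W) := (hB.neg _ _).symm
  have f₂ : B b (y₂ : W) = 0 := iso₂ _ mb _ y₂.2
  have e₂ : B ((y₃ : W) - b) ((y₂ : W) - a) = 0 := iso₄ _ qb _ qa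
  have g₂ : B a b = -B b a := (hB.neg b a).symm
  have k₂ : B (y₂ : W) (y₃ : W) = -B (y₃ : W) (y₂ : W) := (hB.neg _ _).symm
  have f₃ : B c (y₃ : W) = 0 := iso₃ _ mc _ y₃.2
  have e₃ : B ((y₁ : W) - c) ((y₃ : W) - b) = 0 := iso₄ _ qc _ qb
  have g₃ : B b c = -B c b := (hB.neg c b).symm
  have k₃ : B (y₃ : W) (y₁ : W) = -B (y₁ : W) (y₃ : W) := (hB.neg _ _).symm
  simp only [map_sub, LinearMap.sub_apply] at e₁ e₂ e₃
  simp only [map_add, map_sub, LinearMap.add_apply]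
  linear_combination (k₁ + g₁ - e₁ - f₁) + (k₂ + g₂ - e₂ - f₂) + (k₃ + g₃ - e₃ - f₃) + s₁ + s₂ + s₃

end Algebra

/-! ## §1 The Leray–Maslov–Weil index: definition, unit modulus, symplectic invariance, dihedral symmetry -/

section Defs

variable {F : Type*} [Field F] [ValuativeRel F] [TopologicalSpace F] [IsNonarchimedeanLocalField F]
  (ψ : AddChar F Circle) [MeasurableSpace F] (μ : Measure F) [Invertible (2 : F)]
variable {V : Type*} [AddCommGroup V] [Module F V] [FiniteDimensional F V]

/-- **the Leray–Maslov–Weil index `μ_ψ(ℓ₁, ℓ₂, ℓ₃) = γ(ψ ∘ Q_{ℓ₁,ℓ₂,ℓ₃})`** of three subspaces of `(V, B)` over a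
non-archimedean local field of characteristic `≠ 2`: the Weil index of Kashiwara's quadratic form
`Q(x₁ + x₂ + x₃) = B(x₁, x₂) + B(x₂, x₃) + B(x₃, x₁)` on `ℓ₁ ⊕ ℓ₂ ⊕ ℓ₃` — "the Weil index of the Leray invariant of the
Lagrangian subspaces" (for pairwise transverse Lagrangians it is the index of Rao's `q(L₁, L₂, L₃)`,
`lerayWeilIndex_eq_weilIndexSpace_transverseForm`). [cite: Rangarao1993, p. 336 and Def. 2.4 p. 339;
LionVergne1980, §1.5.1] -/
def lerayWeilIndex (B : LinearMap.BilinForm F V) (ℓ₁ ℓ₂ ℓ₃ : Submodule F V) : ℂ :=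
  weilIndexSpace ψ μ (kashiwaraForm B ℓ₁ ℓ₂ ℓ₃)

/-- unfolding. [cite: LionVergne1980, §1.5.1] -/
theorem lerayWeilIndex_def (B : LinearMap.BilinForm F V) (ℓ₁ ℓ₂ ℓ₃ : Submodule F V) :
    lerayWeilIndex ψ μ B ℓ₁ ℓ₂ ℓ₃ = weilIndexSpace ψ μ (kashiwaraForm B ℓ₁ ℓ₂ ℓ₃) := rfl

end Defs

section Index

variable {F : Type*} [Field F] [ValuativeRel F] [TopologicalSpace F] [IsNonarchimedeanLocalField F]
variable [MeasurableSpace F] [BorelSpace F] (μ : Measure F) [μ.IsAddHaarMeasure] {ψ : AddChar F Circle}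
  [Invertible (2 : F)]
variable {V : Type*} [AddCommGroup V] [Module F V] [FiniteDimensional F V]

/-- **`|μ(ℓ₁, ℓ₂, ℓ₃)| = 1`** ("`c(g, g')` est une racine huitième de l'unité" — here the unit modulus).
[cite: MoeglinVignerasWaldspurger1987, Chap. 3 §I.3, remarque b)] -/
theorem norm_lerayWeilIndex (hψ : ψ.IsContinuousNontrivial) (B : LinearMap.BilinForm F V) (ℓ₁ ℓ₂ ℓ₃ : Submodule F V) :
    ‖lerayWeilIndex ψ μ B ℓ₁ ℓ₂ ℓ₃‖ = 1 :=
  norm_weilIndexSpace μ hψ _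

/-- `μ · conj μ = 1`. [cite: MoeglinVignerasWaldspurger1987, Chap. 3 §I.3, remarque b)] -/
theorem lerayWeilIndex_mul_conj (hψ : ψ.IsContinuousNontrivial) (B : LinearMap.BilinForm F V)
    (ℓ₁ ℓ₂ ℓ₃ : Submodule F V) :
    lerayWeilIndex ψ μ B ℓ₁ ℓ₂ ℓ₃ * (starRingEnd ℂ) (lerayWeilIndex ψ μ B ℓ₁ ℓ₂ ℓ₃) = 1 :=
  weilIndexSpace_mul_conj μ hψ _

/-- `μ ≠ 0`. [cite: MoeglinVignerasWaldspurger1987, Chap. 3 §I.3, remarque b)] -/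
theorem lerayWeilIndex_ne_zero (hψ : ψ.IsContinuousNontrivial) (B : LinearMap.BilinForm F V)
    (ℓ₁ ℓ₂ ℓ₃ : Submodule F V) : lerayWeilIndex ψ μ B ℓ₁ ℓ₂ ℓ₃ ≠ 0 :=
  weilIndexSpace_ne_zero μ hψ _

/-- `μ` does not depend on the Haar measure. [cite: Weil1964, Chap. II n° 24, p. 173] -/
theorem lerayWeilIndex_eq_of_isAddHaarMeasure (μ' : Measure F) [μ'.IsAddHaarMeasure] (hψ : ψ.IsContinuousNontrivial)
    (B : LinearMap.BilinForm F V) (ℓ₁ ℓ₂ ℓ₃ : Submodule F V) :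
    lerayWeilIndex ψ μ' B ℓ₁ ℓ₂ ℓ₃ = lerayWeilIndex ψ μ B ℓ₁ ℓ₂ ℓ₃ :=
  weilIndexSpace_eq_of_isAddHaarMeasure μ μ' hψ _

/-- **symplectic invariance `μ(gℓ₁, gℓ₂, gℓ₃) = μ(ℓ₁, ℓ₂, ℓ₃)`** for every automorphism `g` of `V` preserving `B`
(`g` induces an isometry of Kashiwara's forms; [LionVergne1980, 1.5.2] for `τ`, [Rangarao1993, Thm 2.11]:
`q(L₁σ, L₂σ, L₃σ) = q(L₁, L₂, L₃)`). [cite: LionVergne1980, §1.5.2; Rangarao1993, Thm 2.11 p. 344] -/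
theorem lerayWeilIndex_map (hψ : ψ.IsContinuousNontrivial) (B : LinearMap.BilinForm F V) (g : V ≃ₗ[F] V)
    (hg : ∀ x y, B (g x) (g y) = B x y) (ℓ₁ ℓ₂ ℓ₃ : Submodule F V) :
    lerayWeilIndex ψ μ B (ℓ₁.map (g : V →ₗ[F] V)) (ℓ₂.map (g : V →ₗ[F] V)) (ℓ₃.map (g : V →ₗ[F] V)) =
      lerayWeilIndex ψ μ B ℓ₁ ℓ₂ ℓ₃ := by
  set E : (ℓ₁ × ℓ₂ × ℓ₃) ≃ₗ[F]
      (ℓ₁.map (g : V →ₗ[F] V) × ℓ₂.map (g : V →ₗ[F] V) × ℓ₃.map (g : V →ₗ[F] V)) :=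
    (g.submoduleMap ℓ₁).prodCongr ((g.submoduleMap ℓ₂).prodCongr (g.submoduleMap ℓ₃)) with hE
  have hcomp : (kashiwaraForm B (ℓ₁.map (g : V →ₗ[F] V)) (ℓ₂.map (g : V →ₗ[F] V))
      (ℓ₃.map (g : V →ₗ[F] V))).comp (E : _ →ₗ[F] _) = kashiwaraForm B ℓ₁ ℓ₂ ℓ₃ := by
    ext x
    rw [QuadraticMap.comp_apply, kashiwaraForm_apply, kashiwaraForm_apply]
    simp only [hE, LinearEquiv.coe_coe, LinearEquiv.prodCongr_apply, LinearEquiv.submoduleMap_apply, hg]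
  rw [lerayWeilIndex, lerayWeilIndex, ← hcomp, weilIndexSpace_comp_linearEquiv μ hψ]

/-- **a transposition of the first two planes conjugates the index**: `μ(ℓ₂, ℓ₁, ℓ₃) = conj μ(ℓ₁, ℓ₂, ℓ₃)` for `B`
alternating (`Q_{213} ≅ -Q_{123}` and `γ(-Q) = conj γ(Q)`; [LionVergne1980, 1.5.3] `τ(ℓ₂, ℓ₁, ℓ₃) = -τ(ℓ₁, ℓ₂, ℓ₃)`).
[cite: LionVergne1980, §1.5.3; Rangarao1993, Appendix Thm A.2 (2) p. 366] -/
theorem lerayWeilIndex_swap₁₂ (hψ : ψ.IsContinuousNontrivial) {B : LinearMap.BilinForm F V} (hB : LinearMap.IsAlt B)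
    (ℓ₁ ℓ₂ ℓ₃ : Submodule F V) :
    lerayWeilIndex ψ μ B ℓ₂ ℓ₁ ℓ₃ = (starRingEnd ℂ) (lerayWeilIndex ψ μ B ℓ₁ ℓ₂ ℓ₃) := by
  have h := congrArg (weilIndexSpace ψ μ) (kashiwaraForm_comp_swap₁₂ hB ℓ₁ ℓ₂ ℓ₃)
  rw [weilIndexSpace_comp_linearEquiv μ hψ, weilIndexSpace_neg μ hψ] at h
  rw [lerayWeilIndex, lerayWeilIndex, h, Complex.conj_conj]

/-- **a transposition of the last two planes conjugates the index**: `μ(ℓ₁, ℓ₃, ℓ₂) = conj μ(ℓ₁, ℓ₂, ℓ₃)` for `B`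
alternating. [cite: LionVergne1980, §1.5.3; Rangarao1993, Appendix Thm A.2 (2) p. 366] -/
theorem lerayWeilIndex_swap₂₃ (hψ : ψ.IsContinuousNontrivial) {B : LinearMap.BilinForm F V} (hB : LinearMap.IsAlt B)
    (ℓ₁ ℓ₂ ℓ₃ : Submodule F V) :
    lerayWeilIndex ψ μ B ℓ₁ ℓ₃ ℓ₂ = (starRingEnd ℂ) (lerayWeilIndex ψ μ B ℓ₁ ℓ₂ ℓ₃) := by
  have h := congrArg (weilIndexSpace ψ μ) (kashiwaraForm_comp_swap₂₃ hB ℓ₁ ℓ₂ ℓ₃)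
  rw [weilIndexSpace_comp_linearEquiv μ hψ, weilIndexSpace_neg μ hψ] at h
  rw [lerayWeilIndex, lerayWeilIndex, h, Complex.conj_conj]

/-- **cyclic symmetry `μ(ℓ₂, ℓ₃, ℓ₁) = μ(ℓ₁, ℓ₂, ℓ₃)`** for `B` alternating (two transpositions).
[cite: LionVergne1980, §1.5.3] -/
theorem lerayWeilIndex_cycle (hψ : ψ.IsContinuousNontrivial) {B : LinearMap.BilinForm F V} (hB : LinearMap.IsAlt B)
    (ℓ₁ ℓ₂ ℓ₃ : Submodule F V) : lerayWeilIndex ψ μ B ℓ₂ ℓ₃ ℓ₁ = lerayWeilIndex ψ μ B ℓ₁ ℓ₂ ℓ₃ := by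
  rw [lerayWeilIndex_swap₂₃ μ hψ hB ℓ₂ ℓ₁ ℓ₃, lerayWeilIndex_swap₁₂ μ hψ hB ℓ₁ ℓ₂ ℓ₃, Complex.conj_conj]

/-- reversal `μ(ℓ₃, ℓ₂, ℓ₁) = conj μ(ℓ₁, ℓ₂, ℓ₃)` for `B` alternating. [cite: LionVergne1980, §1.5.3] -/
theorem lerayWeilIndex_reverse (hψ : ψ.IsContinuousNontrivial) {B : LinearMap.BilinForm F V} (hB : LinearMap.IsAlt B)
    (ℓ₁ ℓ₂ ℓ₃ : Submodule F V) :
    lerayWeilIndex ψ μ B ℓ₃ ℓ₂ ℓ₁ = (starRingEnd ℂ) (lerayWeilIndex ψ μ B ℓ₁ ℓ₂ ℓ₃) := by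
  rw [← lerayWeilIndex_cycle μ hψ hB ℓ₃ ℓ₂ ℓ₁]
  exact lerayWeilIndex_swap₁₂ μ hψ hB ℓ₁ ℓ₂ ℓ₃

/-! ## §2 Normalisation: the index is `1` when two of the planes are orthogonal -/

/-- **`μ(ℓ₁, ℓ₂, ℓ₃) = 1` whenever `B(ℓ₁, ℓ₂) = 0`**: then Kashiwara's form `B(x₂, x₃) + B(x₃, x₁)` is SPLIT with
respect to `(ℓ₁ ⊕ ℓ₂) ⊕ ℓ₃` (it vanishes on `ℓ₁ ⊕ ℓ₂ ⊕ 0` and on `0 ⊕ 0 ⊕ ℓ₃`), so its Weil index is `1`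
(`weilIndexSpace_eq_one_of_split`). No hypothesis on `B`. [cite: Rangarao1993, §2.7 p. 348 ("the Leray invariant is
trivial when two of them coincide") with Appendix Thm A.3 p. 367] -/
theorem lerayWeilIndex_eq_one_of_isOrtho₁₂ (hψ : ψ.IsContinuousNontrivial) (B : LinearMap.BilinForm F V)
    {ℓ₁ ℓ₂ : Submodule F V} (h : ∀ x ∈ ℓ₁, ∀ y ∈ ℓ₂, B x y = 0) (ℓ₃ : Submodule F V) :
    lerayWeilIndex ψ μ B ℓ₁ ℓ₂ ℓ₃ = 1 := by
  let E : ((ℓ₁ × ℓ₂) × ℓ₃) ≃ₗ[F] (ℓ₁ × ℓ₂ × ℓ₃) := LinearEquiv.prodAssoc F ℓ₁ ℓ₂ ℓ₃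
  have hE : ∀ z : (ℓ₁ × ℓ₂) × ℓ₃, E z = (z.1.1, z.1.2, z.2) := fun z => rfl
  rw [lerayWeilIndex, ← weilIndexSpace_comp_linearEquiv μ hψ _ E]
  refine weilIndexSpace_eq_one_of_split μ hψ _ (fun m => ?_) (fun n => ?_)
  · rw [QuadraticMap.comp_apply, LinearEquiv.coe_coe, hE, kashiwaraForm_apply]
    simp only [ZeroMemClass.coe_zero, map_zero, LinearMap.zero_apply, add_zero, h _ m.1.2 _ m.2.2]
  · rw [QuadraticMap.comp_apply, LinearEquiv.coe_coe, hE, kashiwaraForm_apply]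
    simp only [Prod.fst_zero, Prod.snd_zero, ZeroMemClass.coe_zero, map_zero, LinearMap.zero_apply, zero_add]

/-- `μ(ℓ₁, ℓ₂, ℓ₃) = 1` whenever `B(ℓ₂, ℓ₃) = 0`. [cite: Rangarao1993, §2.7 p. 348 with Appendix Thm A.3 p. 367] -/
theorem lerayWeilIndex_eq_one_of_isOrtho₂₃ (hψ : ψ.IsContinuousNontrivial) (B : LinearMap.BilinForm F V)
    (ℓ₁ : Submodule F V) {ℓ₂ ℓ₃ : Submodule F V} (h : ∀ x ∈ ℓ₂, ∀ y ∈ ℓ₃, B x y = 0) :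
    lerayWeilIndex ψ μ B ℓ₁ ℓ₂ ℓ₃ = 1 := by
  -- regroup `ℓ₁ × ℓ₂ × ℓ₃` as `(ℓ₂ × ℓ₃) × ℓ₁`
  let E : ((ℓ₂ × ℓ₃) × ℓ₁) ≃ₗ[F] (ℓ₁ × ℓ₂ × ℓ₃) := LinearEquiv.prodComm F (ℓ₂ × ℓ₃) ℓ₁
  have hE : ∀ z : (ℓ₂ × ℓ₃) × ℓ₁, E z = (z.2, z.1.1, z.1.2) := fun z => rfl
  rw [lerayWeilIndex, ← weilIndexSpace_comp_linearEquiv μ hψ _ E]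
  refine weilIndexSpace_eq_one_of_split μ hψ _ (fun m => ?_) (fun n => ?_)
  · rw [QuadraticMap.comp_apply, LinearEquiv.coe_coe, hE, kashiwaraForm_apply]
    simp only [ZeroMemClass.coe_zero, map_zero, LinearMap.zero_apply, add_zero, h _ m.1.2 _ m.2.2]
  · rw [QuadraticMap.comp_apply, LinearEquiv.coe_coe, hE, kashiwaraForm_apply]
    simp only [Prod.fst_zero, Prod.snd_zero, ZeroMemClass.coe_zero, map_zero, LinearMap.zero_apply, zero_add]

/-- `μ(ℓ₁, ℓ₂, ℓ₃) = 1` whenever `B(ℓ₃, ℓ₁) = 0`. [cite: Rangarao1993, §2.7 p. 348 with Appendix Thm A.3 p. 367] -/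
theorem lerayWeilIndex_eq_one_of_isOrtho₃₁ (hψ : ψ.IsContinuousNontrivial) (B : LinearMap.BilinForm F V)
    {ℓ₁ : Submodule F V} (ℓ₂ : Submodule F V) {ℓ₃ : Submodule F V} (h : ∀ x ∈ ℓ₃, ∀ y ∈ ℓ₁, B x y = 0) :
    lerayWeilIndex ψ μ B ℓ₁ ℓ₂ ℓ₃ = 1 := by
  -- regroup `ℓ₁ × ℓ₂ × ℓ₃` as `(ℓ₃ × ℓ₁) × ℓ₂`
  let E : ((ℓ₃ × ℓ₁) × ℓ₂) ≃ₗ[F] (ℓ₁ × ℓ₂ × ℓ₃) :=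
    { toFun := fun z => (z.1.2, z.2, z.1.1)
      invFun := fun x => ((x.2.2, x.1), x.2.1)
      map_add' := fun _ _ => rfl
      map_smul' := fun _ _ => rfl
      left_inv := fun _ => rfl
      right_inv := fun _ => rfl }
  have hE : ∀ z : (ℓ₃ × ℓ₁) × ℓ₂, E z = (z.1.2, z.2, z.1.1) := fun z => rfl
  rw [lerayWeilIndex, ← weilIndexSpace_comp_linearEquiv μ hψ _ E]
  refine weilIndexSpace_eq_one_of_split μ hψ _ (fun m => ?_) (fun n => ?_)
  · rw [QuadraticMap.comp_apply, LinearEquiv.coe_coe, hE, kashiwaraForm_apply]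
    simp only [ZeroMemClass.coe_zero, map_zero, LinearMap.zero_apply, zero_add, h _ m.1.2 _ m.2.2]
  · rw [QuadraticMap.comp_apply, LinearEquiv.coe_coe, hE, kashiwaraForm_apply]
    simp only [Prod.fst_zero, Prod.snd_zero, ZeroMemClass.coe_zero, map_zero, LinearMap.zero_apply, add_zero]

/-- **`μ(ℓ, ℓ, ℓ₃) = 1` for `ℓ` isotropic** ("the Leray invariant is trivial when two of them coincide").
[cite: Rangarao1993, §2.7 p. 348] -/
theorem lerayWeilIndex_self₁₂ (hψ : ψ.IsContinuousNontrivial) (B : LinearMap.BilinForm F V) {ℓ : Submodule F V}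
    (hℓ : ∀ x ∈ ℓ, ∀ y ∈ ℓ, B x y = 0) (ℓ₃ : Submodule F V) : lerayWeilIndex ψ μ B ℓ ℓ ℓ₃ = 1 :=
  lerayWeilIndex_eq_one_of_isOrtho₁₂ μ hψ B hℓ ℓ₃

/-- **`μ(ℓ₁, ℓ, ℓ) = 1` for `ℓ` isotropic**. [cite: Rangarao1993, §2.7 p. 348] -/
theorem lerayWeilIndex_self₂₃ (hψ : ψ.IsContinuousNontrivial) (B : LinearMap.BilinForm F V) (ℓ₁ : Submodule F V)
    {ℓ : Submodule F V} (hℓ : ∀ x ∈ ℓ, ∀ y ∈ ℓ, B x y = 0) : lerayWeilIndex ψ μ B ℓ₁ ℓ ℓ = 1 :=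
  lerayWeilIndex_eq_one_of_isOrtho₂₃ μ hψ B ℓ₁ hℓ

/-- **`μ(ℓ, ℓ₂, ℓ) = 1` for `ℓ` isotropic**. [cite: Rangarao1993, §2.7 p. 348] -/
theorem lerayWeilIndex_self₃₁ (hψ : ψ.IsContinuousNontrivial) (B : LinearMap.BilinForm F V) {ℓ : Submodule F V}
    (ℓ₂ : Submodule F V) (hℓ : ∀ x ∈ ℓ, ∀ y ∈ ℓ, B x y = 0) : lerayWeilIndex ψ μ B ℓ ℓ₂ ℓ = 1 :=
  lerayWeilIndex_eq_one_of_isOrtho₃₁ μ hψ B ℓ₂ hℓ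

/-! ## §3 The transverse case: the index of Rao's Leray invariant ([LionVergne1980, 1.5.4]; [Rangarao1993, Def. 2.4]) -/

/-- **the transverse case.** Let `B` be alternating, `ℓ₁, ℓ₃` isotropic and complementary (`V = ℓ₁ ⊕ ℓ₃`), `ℓ₂` any
subspace. Then `μ(ℓ₁, ℓ₂, ℓ₃) = γ(ψ ∘ S)` for the quadratic form `S(x) = B(p₁₃ x, p₃₁ x)` on `ℓ₂` (`transverseForm`):
Kashiwara's `Q ≅ S ⊕ H` with `H(u, v) = B(u, v)` on `ℓ₁ × ℓ₃` split, `γ(H) = 1`. For three pairwise transverse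
Lagrangians `S` is non-degenerate and its isometry class is Rao's Leray invariant `q(L₁, L₂, L₃)` (a form on the middle
plane), so `μ` is "the Weil index of the Leray invariant". [cite: LionVergne1980, §1.5.4; Rangarao1993, Def. 2.4 p. 339] -/
theorem lerayWeilIndex_eq_weilIndexSpace_transverseForm (hψ : ψ.IsContinuousNontrivial) {B : LinearMap.BilinForm F V}
    (hB : LinearMap.IsAlt B) {ℓ₁ ℓ₂ ℓ₃ : Submodule F V} (h : IsCompl ℓ₁ ℓ₃)
    (h₁ : ∀ x ∈ ℓ₁, ∀ y ∈ ℓ₁, B x y = 0) (h₃ : ∀ x ∈ ℓ₃, ∀ y ∈ ℓ₃, B x y = 0) :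
    lerayWeilIndex ψ μ B ℓ₁ ℓ₂ ℓ₃ = weilIndexSpace ψ μ (transverseForm B ℓ₁ ℓ₂ ℓ₃ h) := by
  rw [lerayWeilIndex, ← prod_comp_splitEquiv' hB h h₁ h₃, weilIndexSpace_comp_linearEquiv μ hψ,
    weilIndexSpace_prod μ hψ, weilIndexSpace_pairingQF μ hψ, mul_one]

/-! ## §4 The chain condition ([LionVergne1980, 1.5.8]) -/

/-- **the chain condition, transverse case** (step (i) of [LionVergne1980, 1.5.8]): for `B` alternating,
`ℓ₁, ℓ₂, ℓ₃, ℓ₄` isotropic and `ℓ₄` complementary to each of `ℓ₁, ℓ₂, ℓ₃`,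
`μ(ℓ₁, ℓ₂, ℓ₃) = μ(ℓ₁, ℓ₂, ℓ₄) μ(ℓ₂, ℓ₃, ℓ₄) μ(ℓ₃, ℓ₁, ℓ₄)`: `Q_{123} ≅ S_{314} ⊕ S_{124} ⊕ S_{234}` and
`μ(ℓᵢ, ℓⱼ, ℓ₄) = γ(S_{ij4})` by the transverse case. [cite: LionVergne1980, §1.5.8] -/
theorem lerayWeilIndex_chain_of_isCompl (hψ : ψ.IsContinuousNontrivial) {B : LinearMap.BilinForm F V}
    (hB : LinearMap.IsAlt B) {ℓ₁ ℓ₂ ℓ₃ ℓ₄ : Submodule F V} (h₁ : IsCompl ℓ₁ ℓ₄) (h₂ : IsCompl ℓ₂ ℓ₄)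
    (h₃ : IsCompl ℓ₃ ℓ₄) (iso₁ : ∀ x ∈ ℓ₁, ∀ y ∈ ℓ₁, B x y = 0) (iso₂ : ∀ x ∈ ℓ₂, ∀ y ∈ ℓ₂, B x y = 0)
    (iso₃ : ∀ x ∈ ℓ₃, ∀ y ∈ ℓ₃, B x y = 0) (iso₄ : ∀ x ∈ ℓ₄, ∀ y ∈ ℓ₄, B x y = 0) :
    lerayWeilIndex ψ μ B ℓ₁ ℓ₂ ℓ₃ =
      lerayWeilIndex ψ μ B ℓ₁ ℓ₂ ℓ₄ * lerayWeilIndex ψ μ B ℓ₂ ℓ₃ ℓ₄ * lerayWeilIndex ψ μ B ℓ₃ ℓ₁ ℓ₄ := by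
  have h := congrArg (weilIndexSpace ψ μ) (kashiwaraForm_comp_chainEquiv' hB h₁ h₂ h₃ iso₁ iso₂ iso₃ iso₄)
  rw [weilIndexSpace_comp_linearEquiv μ hψ, weilIndexSpace_prod μ hψ, weilIndexSpace_prod μ hψ] at h
  rw [lerayWeilIndex, h, lerayWeilIndex_eq_weilIndexSpace_transverseForm μ hψ hB h₁ iso₁ iso₄,
    lerayWeilIndex_eq_weilIndexSpace_transverseForm μ hψ hB h₂ iso₂ iso₄,
    lerayWeilIndex_eq_weilIndexSpace_transverseForm μ hψ hB h₃ iso₃ iso₄]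
  ring

omit [MeasurableSpace F] [BorelSpace F] [Invertible (2 : F)] in
/-- a non-archimedean local field is infinite (the powers of an element of valuation `< 1` are distinct).
[folklore] -/
private theorem infinite_of_isNonarchimedeanLocalField : Infinite F := by
  obtain ⟨x, hx0, hx1⟩ := Valuation.IsNontrivial.exists_lt_one (v := ValuativeRel.valuation F)
  have hpos : 0 < ValuativeRel.valuation F x := zero_lt_iff.2 ((Valuation.ne_zero_iff _).2 hx0)
  have hanti : StrictAnti fun n : ℕ => (ValuativeRel.valuation F x) ^ n := fun m n hmn =>
    pow_lt_pow_right_of_lt_one₀ hpos hx1 hmn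
  refine Infinite.of_injective (fun n : ℕ => x ^ n) fun m n hmn => ?_
  have h : (ValuativeRel.valuation F x) ^ m = (ValuativeRel.valuation F x) ^ n := by
    rw [← map_pow, ← map_pow]
    exact congrArg _ hmn
  exact hanti.injective h

/-- **the chain condition** ([LionVergne1980, 1.5.8 Proposition] for the Weil index in place of the signature): let
`B` be alternating and non-degenerate on the finite-dimensional `V` (a symplectic space over the local field `F`) and
`ℓ₁, ℓ₂, ℓ₃, ℓ₄` Lagrangians (`ℓᵢ^⊥ = ℓᵢ`). Then
`μ(ℓ₁, ℓ₂, ℓ₃) = μ(ℓ₁, ℓ₂, ℓ₄) μ(ℓ₂, ℓ₃, ℓ₄) μ(ℓ₃, ℓ₁, ℓ₄)`.  Proof as printed, step (ii): take a Lagrangian `m`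
transverse to `ℓ₁, …, ℓ₄` (a local field is infinite), express each `μ(ℓᵢ, ℓⱼ, ℓₖ)` through the `μ(ℓᵢ, ℓⱼ, m)` by the
transverse case; the cross terms cancel by `μ(ℓ₄, ℓᵢ, m) μ(ℓᵢ, ℓ₄, m) = |μ|² = 1`. This is the identity that makes
`(g, g') ↦ μ(ℓ, gℓ, gg'ℓ)` a `2`-cocycle on `Sp(B)`. [cite: LionVergne1980, §1.5.8; MoeglinVignerasWaldspurger1987,
Chap. 3 §I.3] -/
theorem lerayWeilIndex_chain (hψ : ψ.IsContinuousNontrivial) {B : LinearMap.BilinForm F V} (hB : LinearMap.IsAlt B)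
    (hN : B.Nondegenerate) {ℓ₁ ℓ₂ ℓ₃ ℓ₄ : Submodule F V} (h₁ : B.orthogonal ℓ₁ = ℓ₁) (h₂ : B.orthogonal ℓ₂ = ℓ₂)
    (h₃ : B.orthogonal ℓ₃ = ℓ₃) (h₄ : B.orthogonal ℓ₄ = ℓ₄) :
    lerayWeilIndex ψ μ B ℓ₁ ℓ₂ ℓ₃ =
      lerayWeilIndex ψ μ B ℓ₁ ℓ₂ ℓ₄ * lerayWeilIndex ψ μ B ℓ₂ ℓ₃ ℓ₄ * lerayWeilIndex ψ μ B ℓ₃ ℓ₁ ℓ₄ := by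
  haveI : Infinite F := infinite_of_isNonarchimedeanLocalField
  obtain ⟨m, hm, hc⟩ := exists_orthogonal_eq_self_isCompl_forall hB hN ![ℓ₁, ℓ₂, ℓ₃, ℓ₄] (by
    intro i
    fin_cases i
    · exact h₁
    · exact h₂
    · exact h₃
    · exact h₄)
  have c₁ : IsCompl ℓ₁ m := hc 0
  have c₂ : IsCompl ℓ₂ m := hc 1
  have c₃ : IsCompl ℓ₃ m := hc 2
  have c₄ : IsCompl ℓ₄ m := hc 3
  have i₁ := isotropic_of_orthogonal_eq_self h₁
  have i₂ := isotropic_of_orthogonal_eq_self h₂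
  have i₃ := isotropic_of_orthogonal_eq_self h₃
  have i₄ := isotropic_of_orthogonal_eq_self h₄
  have im := isotropic_of_orthogonal_eq_self hm
  have e₁₂₃ := lerayWeilIndex_chain_of_isCompl μ hψ hB c₁ c₂ c₃ i₁ i₂ i₃ im
  have e₁₂₄ := lerayWeilIndex_chain_of_isCompl μ hψ hB c₁ c₂ c₄ i₁ i₂ i₄ im
  have e₂₃₄ := lerayWeilIndex_chain_of_isCompl μ hψ hB c₂ c₃ c₄ i₂ i₃ i₄ im
  have e₃₁₄ := lerayWeilIndex_chain_of_isCompl μ hψ hB c₃ c₁ c₄ i₃ i₁ i₄ im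
  -- the cross terms: `μ(ℓ₄, ℓᵢ, m) = conj μ(ℓᵢ, ℓ₄, m)` and `μ · conj μ = 1`
  have s₁ := lerayWeilIndex_swap₁₂ μ hψ hB ℓ₁ ℓ₄ m
  have s₂ := lerayWeilIndex_swap₁₂ μ hψ hB ℓ₂ ℓ₄ m
  have s₃ := lerayWeilIndex_swap₁₂ μ hψ hB ℓ₃ ℓ₄ m
  have n₁ := lerayWeilIndex_mul_conj μ hψ B ℓ₁ ℓ₄ m
  have n₂ := lerayWeilIndex_mul_conj μ hψ B ℓ₂ ℓ₄ m
  have n₃ := lerayWeilIndex_mul_conj μ hψ B ℓ₃ ℓ₄ m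
  rw [e₁₂₃, e₁₂₄, e₂₃₄, e₃₁₄, s₁, s₂, s₃]
  set A := lerayWeilIndex ψ μ B ℓ₁ ℓ₂ m * lerayWeilIndex ψ μ B ℓ₂ ℓ₃ m * lerayWeilIndex ψ μ B ℓ₃ ℓ₁ m with hA
  set N₁ := lerayWeilIndex ψ μ B ℓ₁ ℓ₄ m * (starRingEnd ℂ) (lerayWeilIndex ψ μ B ℓ₁ ℓ₄ m) with hN₁
  set N₂ := lerayWeilIndex ψ μ B ℓ₂ ℓ₄ m * (starRingEnd ℂ) (lerayWeilIndex ψ μ B ℓ₂ ℓ₄ m) with hN₂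
  linear_combination (-A) * n₁ + (-(A * N₁)) * n₂ + (-(A * N₁ * N₂)) * n₃

/-- the chain condition in cocycle form: `μ(ℓ₂, ℓ₃, ℓ₄) · conj μ(ℓ₁, ℓ₃, ℓ₄) · μ(ℓ₁, ℓ₂, ℓ₄) = μ(ℓ₁, ℓ₂, ℓ₃)` for any
four Lagrangians. [cite: LionVergne1980, §1.5.8 with §1.5.3] -/
theorem lerayWeilIndex_cocycle (hψ : ψ.IsContinuousNontrivial) {B : LinearMap.BilinForm F V} (hB : LinearMap.IsAlt B)
    (hN : B.Nondegenerate) {ℓ₁ ℓ₂ ℓ₃ ℓ₄ : Submodule F V} (h₁ : B.orthogonal ℓ₁ = ℓ₁) (h₂ : B.orthogonal ℓ₂ = ℓ₂)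
    (h₃ : B.orthogonal ℓ₃ = ℓ₃) (h₄ : B.orthogonal ℓ₄ = ℓ₄) :
    lerayWeilIndex ψ μ B ℓ₂ ℓ₃ ℓ₄ * (starRingEnd ℂ) (lerayWeilIndex ψ μ B ℓ₁ ℓ₃ ℓ₄) *
        lerayWeilIndex ψ μ B ℓ₁ ℓ₂ ℓ₄ = lerayWeilIndex ψ μ B ℓ₁ ℓ₂ ℓ₃ := by
  rw [lerayWeilIndex_chain μ hψ hB hN h₁ h₂ h₃ h₄, ← lerayWeilIndex_swap₁₂ μ hψ hB ℓ₁ ℓ₃ ℓ₄]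
  ring

/-- the right-hand side of the chain condition does not depend on the fourth Lagrangian:
`μ(ℓ₁, ℓ₂, ℓ) μ(ℓ₂, ℓ₃, ℓ) μ(ℓ₃, ℓ₁, ℓ) = μ(ℓ₁, ℓ₂, ℓ') μ(ℓ₂, ℓ₃, ℓ') μ(ℓ₃, ℓ₁, ℓ')`.
[cite: LionVergne1980, §1.5.8 with §1.5.12] -/
theorem lerayWeilIndex_chain_indep (hψ : ψ.IsContinuousNontrivial) {B : LinearMap.BilinForm F V}
    (hB : LinearMap.IsAlt B) (hN : B.Nondegenerate) {ℓ₁ ℓ₂ ℓ₃ ℓ ℓ' : Submodule F V}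
    (h₁ : B.orthogonal ℓ₁ = ℓ₁) (h₂ : B.orthogonal ℓ₂ = ℓ₂) (h₃ : B.orthogonal ℓ₃ = ℓ₃) (h : B.orthogonal ℓ = ℓ)
    (h' : B.orthogonal ℓ' = ℓ') :
    lerayWeilIndex ψ μ B ℓ₁ ℓ₂ ℓ * lerayWeilIndex ψ μ B ℓ₂ ℓ₃ ℓ * lerayWeilIndex ψ μ B ℓ₃ ℓ₁ ℓ =
      lerayWeilIndex ψ μ B ℓ₁ ℓ₂ ℓ' * lerayWeilIndex ψ μ B ℓ₂ ℓ₃ ℓ' * lerayWeilIndex ψ μ B ℓ₃ ℓ₁ ℓ' := by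
  rw [← lerayWeilIndex_chain μ hψ hB hN h₁ h₂ h₃ h, ← lerayWeilIndex_chain μ hψ hB hN h₁ h₂ h₃ h']

end Index

end Literature.NumberTheory.Weil1964
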